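import Summits.AtomisticToContinuum.Crystallization.Theorems.ChartedZeroExcessLayeredLatticeLiouvilleZZZP

/-!
# ChartedZeroExcess · LayeredLatticeLiouville ZZZQ (lens-2 g85 NODE 85, W2 line of record) — LABEL LOCALITY and (XRᴸ) PROVED at the record dials

Lineage `stmt-AtomisticToContinuum-26636` (route ChartedPlanarOrder, sub Crystallization), lens-2 «structural dichotomy (special vs generic)» g85,
critic row 1540 (RULING «W2 ADOPTED»: the mild door `[MCMC](ϑc)` ⟸ (SC) ∧ (XRᴸ) ∧ (X1ᴸ) ∧ (X2ᴸ) ∧ (QCᴸ), tree ZZZP `mildCoolMoatCorePG_W2_record`;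
«(XRᴸ) attackable-S (lens-2 g85)»).  This file DISCHARGES (XRᴸ):

* §1 ★★ **LABEL LOCALITY (KINEMATIC, PROVED).**  For a bond label `lab` of the `ℓ`-zone into a `σ`-separated placed crystal `C` that is
  `ε`-REGISTERED INWARD on the shell `rI < d(·, K) < ℓ` (clause (v) of `IsCoolShadowCrystal`): the label of a WARM atom (`d(p, K) ≤ rΘ`) lies within
  `rI` of `K` (`label_near_of_warm`), hence the label of every `ρ`-core atom lies within `ρ + ε` of `K` (`label_near_of_core`).  Mechanism — the
  lens's dichotomy on the LABEL side: a zone atom's label is NEAR (`d ≤ rI`), SHELL (`rI < d < ℓ − ε`) or FAR (`d ≥ ℓ − ε`); a SHELL label is the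
  registration partner of a COOL atom, which by `C`-separation (`2ε < σ`) and injectivity of `lab` on the zone is the atom itself
  (`cool_of_shell_label`) — impossible for a warm atom; FAR is impossible because it PROPAGATES along the outward cone walk of tree ZZZM
  `exists_path_outward` (bonds go to bonds, a `28/25`-step cannot cross the shell of width `ℓ − ε − rI − 28/25 > 0` while the walk stays within
  `rΘ + 2q + 2·(28/25)` of `K`) and the walk ends at a cool atom, whose label is within `ε` of it.  No walk-length bookkeeping (the naive bound
  `2N·(17/16)` over `N ≈ 25` hops is useless); no chart of `C`, no covering, no count.
* §2 ★★★ **(XRᴸ) `LabelTubeReferenceP` PROVED** for all tube radii / reference levels `(ϑ₀, Rg, sb, dI, dB)` in an explicit polytope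
  (`labelTubeReferenceP_of_dials`) and AT THE RECORD DIALS (`labelTubeReferenceP_record`): by §1 every exterior atom within `Rg` of a patch site
  `lab (xf i)` is a cool ZONE atom, hence `ε`-registered OUTWARD (clause (iv)) — so the extended star of the patch site is `(ϑr + ε)`-tame by tree YZA
  `isTameStarR_of_shadow_registered` — and its own label is a `C`-site distinct from the patch site (injectivity), so it is `≥ σ − ε > dI` away
  (`disjoint_of_mem_bondTube_of_far`); patch sites are pairwise `≥ σ > 2dB` apart (`injective_of_mem_bondTube_of_sep`); members' tameness is tree YP
  `isTameStar_tube_of_reference`.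
* §3 **THE W2 DOOR WITH FOUR HYPOTHESES**: `[MCMC](ϑc)` ⟸ (SC) ∧ (X1ᴸ) ∧ (X2ᴸ) ∧ (QCᴸ) (`mildCoolMoatCorePG_W2_of_four`, tube radii free in the
  polytope; `mildCoolMoatCorePG_W2_marks` at the row-1237 marks `(ϑ₀, Rg, sb, dI, dB) = (1/400, 5, 3/400, 3/400, 3/10)`).

TAGS: §1, §2 KINEMATIC · PROVED (0 sorry).  Remaining open set of the W2 door after this file: (SC) `CoolZoneShadowCrystalP` (special class,
UNDECIDED, instrument ShadowCrystal-T), (X1ᴸ) CERT, (X2ᴸ) ANALYTIC-HEAVY, (QCᴸ) CERT ★residual-deciding (split by the sequel ZZZR).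
Sources: tree ZZZM (`exists_path_outward`), YZ/YZA (`IsCoolShadowCrystal`, tameness transfer), YP (tube tameness), ZC (`IsBondLabel`), ZZZP (W2).

0 sorry; imports = tree ZZZP only; axioms standard.
-/

noncomputable section

open scoped BigOperators Classical InnerProductSpace RealInnerProductSpace
open MeasureTheory Set Metric Filter Topology
open Literature.Geometry.DiscreteGeometry (IsTwoShellGoodSet)
open Literature.MathematicalPhysics.StatisticalMechanics (lennardJones)

namespace Summit.AtomisticToContinuum.Crystallization.Theorems.ChartedZeroExcessLayeredLatticeLiouville

open Summit.AtomisticToContinuum.Crystallization.Theorems.ChartedPlanarOrderRigidityDoor (E3 IsClean)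
open Summit.AtomisticToContinuum.Crystallization.Theorems.ChartedPlanarOrderDensityDichotomy (μS IsSep)
open Summit.AtomisticToContinuum.Crystallization.Theorems.ChartedPlanarOrderCleanScaleP (IsCleanP IsDoorSetP)
open Summit.AtomisticToContinuum.Crystallization.Theorems.ChartedPlanarOrderMesoCut (LayeredHom EnvClose)
open Summit.AtomisticToContinuum.Crystallization.Theorems.ChartedPlanarOrderDoorLayeredOsc (IsTwoShellAffineGood)

/-! ### ZZZQ-1  Label locality: the label of a warm atom is near `K` -/

section LabelLocality

variable {S K C : Set E3} {σC ε rΘ ℓ rI : ℝ} {lab : E3 → E3}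

/-- ★ **A SHELL-LABELLED ZONE ATOM IS COOL AND REGISTERED TO ITS OWN LABEL.**  If the label of a zone atom `p` lies in the inward-registered shell
(`rI < d(lab p, K)` everywhere, `d(lab p, k) < ℓ − ε` for some `k`), then the registration partner of `lab p` is a cool zone atom whose own label is
within `2ε < σC` of `lab p`, hence equal to it, hence (injectivity on the zone) the partner is `p`: so `p` is cool and `dist p (lab p) ≤ ε`.
[this file, g85] -/
theorem cool_of_shell_label (hsepC : IsSep σC C) (hε₀ : 0 ≤ ε) (hε : 2 * ε < σC) (hcoolI : rΘ + ε < rI)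
    (hin : ∀ c ∈ C, (∃ k ∈ K, dist c k < ℓ) → (∀ k ∈ K, rI < dist c k) → ∃ p ∈ S, dist p c ≤ ε)
    (hlab : IsBondLabel ε rΘ ℓ S K C lab) {p : E3} (hp : p ∈ S) (hpz : ∃ k ∈ K, dist p k < ℓ)
    (hfar : ∀ k ∈ K, rI < dist (lab p) k) (hnear : ∃ k ∈ K, dist (lab p) k < ℓ - ε) :
    (∀ k ∈ K, rΘ < dist p k) ∧ dist p (lab p) ≤ ε := by
  have hC : lab p ∈ C := hlab.1 p hp hpz
  obtain ⟨k₁, hk₁, hk₁d⟩ := hnear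
  obtain ⟨p', hp'S, hp'd⟩ := hin (lab p) hC ⟨k₁, hk₁, by linarith⟩ hfar
  have hp'z : ∃ k ∈ K, dist p' k < ℓ := ⟨k₁, hk₁, by linarith [dist_triangle p' (lab p) k₁]⟩
  have hp'cool : ∀ k ∈ K, rΘ < dist p' k := fun k hk => by
    have h1 := hfar k hk
    linarith [dist_triangle (lab p) p' k, dist_comm p' (lab p)]
  have hC' : lab p' ∈ C := hlab.1 p' hp'S hp'z
  have hreg' : dist p' (lab p') ≤ ε := hlab.2.2.2 p' hp'S hp'z hp'cool
  have heq : lab p' = lab p := by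
    by_contra hne
    have h1 := hsepC _ hC' _ hC hne
    linarith [dist_triangle_left (lab p') (lab p) p']
  have hpp : p' = p := hlab.2.2.1 ⟨hp'S, hp'z⟩ ⟨hp, hpz⟩ heq
  subst hpp
  exact ⟨hp'cool, hp'd⟩

/-- ★★ **LABEL LOCALITY FOR WARM ATOMS.**  In a globally bond-charted clean separated `S` with container `K ⊆ B̄(x₀, q)`, a bond label `lab` (collar
`rΘ`, zone `ℓ`) into a `σC`-separated `C` that is `ε`-registered inward on the shell `rI < d(·, K) < ℓ` sends every WARM atom (`d(p, K) ≤ rΘ`) to a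
site within `rI` of `K` — provided `2ε < σC`, `rΘ + ε < rI`, `rI + 28/25 + ε < ℓ` and `rΘ + 2q + 2·(28/25) + 2ε < ℓ` (outward cone walk, tree
ZZZM `exists_path_outward`; FAR labels propagate along the walk and are refuted at its cool end; SHELL labels by `cool_of_shell_label`).
[this file, g85] -/
theorem label_near_of_warm {Ψ : ℤ × ℤ × ℤ → E3} {τS : ℤ → Bool} {x₀ : E3} {δ q : ℝ}
    (hΨ : IsBarlowBondChart S Set.univ Ψ τS) (hsurjΨ : ∀ p ∈ S, ∃ x, Ψ x = p)
    (hclean : ∀ p ∈ S, IsTwoShellGoodSet (1 / 16) (9 / 10) 1 S p) (hδ : 0 < δ) (hsepS : IsSep δ S)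
    (hsepC : IsSep σC C) (hε₀ : 0 ≤ ε) (hε : 2 * ε < σC) (hcoolI : rΘ + ε < rI) (hKq : ∀ k ∈ K, dist k x₀ ≤ q)
    (hzone : rΘ + 2 * q + 2 * (28 / 25) + 2 * ε < ℓ) (hrI : rI + 28 / 25 + ε < ℓ)
    (hin : ∀ c ∈ C, (∃ k ∈ K, dist c k < ℓ) → (∀ k ∈ K, rI < dist c k) → ∃ p ∈ S, dist p c ≤ ε)
    (hlab : IsBondLabel ε rΘ ℓ S K C lab) {p : E3} (hp : p ∈ S) (hwarm : ∃ k ∈ K, dist p k ≤ rΘ) :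
    ∃ k ∈ K, dist (lab p) k ≤ rI := by
  obtain ⟨k₁, hk₁, hpk₁⟩ := hwarm
  by_contra hcon
  push Not at hcon
  set G : ℝ := rΘ + q with hG
  have hS : ∀ a, Ψ a ∈ S := fun a => hΨ.2.1 (mem_univ a)
  have hq₀' : 0 ≤ q := dist_nonneg.trans (hKq k₁ hk₁)
  have hzoneOf : ∀ y : E3, dist y x₀ ≤ G + 28 / 25 → ∃ k ∈ K, dist y k < ℓ := fun y hy =>
    ⟨k₁, hk₁, by rw [hG] at hy; linarith [dist_triangle y x₀ k₁, hKq k₁ hk₁, dist_comm x₀ k₁]⟩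
  have hpz : ∃ k ∈ K, dist p k < ℓ := ⟨k₁, hk₁, by linarith⟩
  -- the warm atom's label is FAR (not SHELL: a shell label would make `p` cool)
  have hfarP : ∀ k ∈ K, ℓ - ε ≤ dist (lab p) k := by
    by_contra h
    push Not at h
    obtain ⟨k, hk, hlt⟩ := h
    have h1 := (cool_of_shell_label hsepC hε₀ hε hcoolI hin hlab hp hpz hcon ⟨k, hk, hlt⟩).1 k₁ hk₁
    linarith
  -- FAR propagates along one Barlow step inside the walk region
  have hstep : ∀ a b : ℤ × ℤ × ℤ, dist (Ψ a) x₀ ≤ G + 28 / 25 → dist (Ψ b) x₀ ≤ G + 28 / 25 → BarlowAdj τS a b →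
      (∀ k ∈ K, ℓ - ε ≤ dist (lab (Ψ a)) k) → ∀ k ∈ K, ℓ - ε ≤ dist (lab (Ψ b)) k := by
    intro a b ha hb hadj hfa
    have haz := hzoneOf _ ha
    have hbz := hzoneOf _ hb
    have hbond : IsBond (Ψ a) (Ψ b) := (hΨ.2.2 a (mem_univ a) b (mem_univ b)).2 hadj
    have hd : dist (lab (Ψ a)) (lab (Ψ b)) ≤ 28 / 25 := (hlab.2.1 _ (hS a) _ (hS b) haz hbz hbond).2
    have hbI : ∀ k ∈ K, rI < dist (lab (Ψ b)) k := fun k hk => by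
      have h1 := hfa k hk
      linarith [dist_triangle (lab (Ψ a)) (lab (Ψ b)) k]
    by_contra h
    push Not at h
    obtain ⟨k, hk, hlt⟩ := h
    have hcool := cool_of_shell_label hsepC hε₀ hε hcoolI hin hlab (hS b) hbz hbI ⟨k, hk, hlt⟩
    have h2 : dist (lab (Ψ b)) (Ψ b) ≤ ε := by rw [dist_comm]; exact hcool.2
    have h3 : dist (Ψ b) k₁ ≤ G + 28 / 25 + q := by
      linarith [dist_triangle (Ψ b) x₀ k₁, hKq k₁ hk₁, dist_comm x₀ k₁]
    have h4 := dist_triangle4 (lab (Ψ a)) (lab (Ψ b)) (Ψ b) k₁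
    have h5 := hfa k₁ hk₁
    rw [hG] at h3
    linarith
  -- hence FAR holds at the end of every walk from `p` inside the region
  obtain ⟨x, rfl⟩ := hsurjΨ p hp
  have hprop : ∀ {c : ℤ × ℤ × ℤ}, Relation.ReflTransGen
      (fun a b => dist (Ψ a) x₀ ≤ G + 28 / 25 ∧ dist (Ψ b) x₀ ≤ G + 28 / 25 ∧ BarlowAdj τS a b) x c →
      ∀ k ∈ K, ℓ - ε ≤ dist (lab (Ψ c)) k := by
    intro c hc
    induction hc with
    | refl => exact hfarP
    | tail _ hbc ih => exact hstep _ _ hbc.1 hbc.2.1 hbc.2.2 ih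
  -- the outward cone walk ends at a COOL zone atom, whose label is within `ε`: contradiction
  have hxG : dist (Ψ x) x₀ ≤ G + 28 / 25 := by
    rw [hG]; linarith [dist_triangle (Ψ x) k₁ x₀, hKq k₁ hk₁]
  obtain ⟨z, hzG, hzV, hpath⟩ := exists_path_outward (G := G) hΨ hsurjΨ hclean hδ hsepS hxG
  have hfarZ := hprop hpath
  have hzz := hzoneOf _ hzV
  have hzcool : ∀ k ∈ K, rΘ < dist (Ψ z) k := fun k hk => by
    rw [hG] at hzG; linarith [dist_triangle (Ψ z) k x₀, hKq k hk]
  have hzreg : dist (Ψ z) (lab (Ψ z)) ≤ ε := hlab.2.2.2 _ (hS z) hzz hzcool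
  have h1 : dist (lab (Ψ z)) k₁ ≤ ε + (G + 28 / 25) + q := by
    linarith [dist_triangle (lab (Ψ z)) (Ψ z) k₁, dist_comm (Ψ z) (lab (Ψ z)), dist_triangle (Ψ z) x₀ k₁, hKq k₁ hk₁,
      dist_comm x₀ k₁]
  have h2 := hfarZ k₁ hk₁
  rw [hG] at h1
  linarith

/-- ★★ **LABEL LOCALITY FOR CORE ATOMS**: under the hypotheses of `label_near_of_warm` and `ρ < ℓ`, `rI ≤ ρ + ε`, the label of every atom of the
`ρ`-core lies within `ρ + ε` of `K` (warm atoms by `label_near_of_warm`; cool core atoms are within `ε` of their labels, clause (iv)).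
[this file, g85] -/
theorem label_near_of_core {Ψ : ℤ × ℤ × ℤ → E3} {τS : ℤ → Bool} {x₀ : E3} {δ q ρ : ℝ}
    (hΨ : IsBarlowBondChart S Set.univ Ψ τS) (hsurjΨ : ∀ p ∈ S, ∃ x, Ψ x = p)
    (hclean : ∀ p ∈ S, IsTwoShellGoodSet (1 / 16) (9 / 10) 1 S p) (hδ : 0 < δ) (hsepS : IsSep δ S)
    (hsepC : IsSep σC C) (hε₀ : 0 ≤ ε) (hε : 2 * ε < σC) (hcoolI : rΘ + ε < rI) (hKq : ∀ k ∈ K, dist k x₀ ≤ q)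
    (hzone : rΘ + 2 * q + 2 * (28 / 25) + 2 * ε < ℓ) (hrI : rI + 28 / 25 + ε < ℓ)
    (hin : ∀ c ∈ C, (∃ k ∈ K, dist c k < ℓ) → (∀ k ∈ K, rI < dist c k) → ∃ p ∈ S, dist p c ≤ ε)
    (hlab : IsBondLabel ε rΘ ℓ S K C lab) (hρℓ : ρ < ℓ) (hrIρ : rI ≤ ρ + ε) {p : E3} (hp : p ∈ coreOf S K ρ) :
    ∃ k ∈ K, dist (lab p) k ≤ ρ + ε := by
  obtain ⟨hpS, k, hk, hpk⟩ := hp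
  by_cases hwarm : ∃ k ∈ K, dist p k ≤ rΘ
  · obtain ⟨k', hk', hd⟩ :=
      label_near_of_warm hΨ hsurjΨ hclean hδ hsepS hsepC hε₀ hε hcoolI hKq hzone hrI hin hlab hpS hwarm
    exact ⟨k', hk', hd.trans hrIρ⟩
  · push Not at hwarm
    have hreg := hlab.2.2.2 p hpS ⟨k, hk, lt_of_le_of_lt hpk hρℓ⟩ hwarm
    exact ⟨k, hk, by linarith [dist_triangle (lab p) p k, dist_comm p (lab p)]⟩

end LabelLocality

/-! ### ZZZQ-2  ★★★ (XRᴸ) proved: the label image of the core is a free tube reference -/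

section LabelTubeReference

/-- ★★★ **(XRᴸ) PROVED ON A DIAL POLYTOPE** (`aHi = 1`).  The label image `lab ∘ xf` of the `ρ`-core is a free tube reference of radii
`(Rg, sb, dI, dB)` and levels `(ϑ₀, ϑ)` w.r.t. the exterior `S ∖ core` and the chart crystal `H`, whenever: `0 ≤ ε`, `2ε < σ` (registration finer
than half the crystal separation), `rΘ + ε < rI ≤ ρ + ε`, `r ≤ ρ < ℓ`, `rI + 28/25 + ε < ℓ`, `rΘ + 2q + 2·(28/25) + 2ε < ℓ` (label locality, §1),
`ρ + ε + Rg < ℓ` (exterior atoms within `Rg` of a patch site are zone atoms), `0 ≤ dB`, `4 + 2dB ≤ Rg`, `4 + 2dB + ε ≤ Rs` (the extended star radius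
`R′ = 4 + 2dB` is shadowed), `2dB < σ`, `dI + ε < σ`, `ϑr + ε ≤ ϑ₀`, `ϑ₀ + max sb dI ≤ ϑ`. [this file, g85] -/
theorem labelTubeReferenceP_of_dials {ϑc ϑ ϑp r rΘ q rsh ρ rm σ ϑr Rs ε rI ℓ ϑ₀ Rg sb dI dB Λ θ s : ℝ}
    (hε₀ : 0 ≤ ε) (hσε : 2 * ε < σ) (hcoolI : rΘ + ε < rI) (hrIρ : rI ≤ ρ + ε) (hrρ : r ≤ ρ) (hρℓ : ρ < ℓ)
    (hrIℓ : rI + 28 / 25 + ε < ℓ) (hzone : rΘ + 2 * q + 2 * (28 / 25) + 2 * ε < ℓ) (hfit : ρ + ε + Rg < ℓ)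
    (hdB₀ : 0 ≤ dB) (hRg : 4 + 2 * dB ≤ Rg) (hRs : 4 + 2 * dB + ε ≤ Rs) (h2dB : 2 * dB < σ) (hdIσ : dI + ε < σ)
    (hϑ₀ : ϑr + ε ≤ ϑ₀) (hϑ : ϑ₀ + max sb dI ≤ ϑ) :
    LabelTubeReferenceP ϑc ϑ ϑp r rΘ q rsh ρ rm σ ϑr Rs ε rI ℓ ϑ₀ Rg sb dI dB 1 Λ θ s := by
  intro δ hδ a ha S hS hsum hgood L w hL x₀ K hKS hKq hTp hTc n xf hxf hrange L' w' U t hcr lab hlab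
  obtain ⟨hdet, hsepH, hsh, hout, hin⟩ := hcr
  obtain ⟨Ψ, τS, hΨ, hsurjΨ⟩ := exists_globalChart_of_isCharted hS.2.2.2.2
  have hclean : ∀ p ∈ S, IsTwoShellGoodSet (1 / 16) (9 / 10) 1 S p := fun p hp => isTwoShellGoodSet_of_isDoorSetP hS hp
  have hsepS : IsSep (27 / 32) S := isSep_of_isDoorSetP le_rfl hS
  have hsepC : IsSep σ (placedCrystal L' w' U t) := isSep_placedCrystal U t hsepH
  have hcore : ∀ i, xf i ∈ coreOf S K ρ := fun i => hrange ▸ Set.mem_range_self i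
  have hxS : ∀ i, xf i ∈ S := fun i => (hcore i).1
  have hxz : ∀ i, ∃ k ∈ K, dist (xf i) k < ℓ := fun i => by
    obtain ⟨-, k, hk, hd⟩ := hcore i
    exact ⟨k, hk, lt_of_le_of_lt hd hρℓ⟩
  have hyC : ∀ i, lab (xf i) ∈ placedCrystal L' w' U t := fun i => hlab.1 _ (hxS i) (hxz i)
  have hnear : ∀ i, ∃ k ∈ K, dist (lab (xf i)) k ≤ ρ + ε := fun i =>
    label_near_of_core hΨ hsurjΨ hclean (by norm_num) hsepS hsepC hε₀ hσε hcoolI hKq hzone hrIℓ hin hlab hρℓ hrIρ (hcore i)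
  -- an exterior atom within `Rg` of a patch site is a zone atom outside the `ρ`-core
  have hXnear : ∀ i, ∀ p ∈ S \ coreOf S K ρ, dist p (lab (xf i)) ≤ Rg →
      (∃ k ∈ K, dist p k < ℓ) ∧ ∀ k ∈ K, ρ < dist p k := fun i p hp hd => by
    have hpc : ∀ k ∈ K, ρ < dist p k := fun k hk => by
      by_contra h
      push Not at h
      exact hp.2 ⟨hp.1, k, hk, h⟩
    obtain ⟨k, hk, hyk⟩ := hnear i
    exact ⟨⟨k, hk, by linarith [dist_triangle p (lab (xf i)) k]⟩, hpc⟩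
  -- registration of the exterior near the patch (clause (iv)), hence extended tameness of the patch sites (tree YZA)
  have hreg : ∀ i, ∀ p ∈ S \ coreOf S K ρ, dist p (lab (xf i)) ≤ 4 + 2 * dB →
      ∃ c ∈ placedCrystal L' w' U t, dist p c ≤ ε := fun i p hp hd => by
    obtain ⟨hz, hc⟩ := hXnear i p hp (hd.trans hRg)
    exact hout p hp.1 hz fun k hk => lt_of_le_of_lt hrρ (hc k hk)
  have href : ∀ i, IsTameStarR (4 + 2 * dB) ϑ₀ ((S \ coreOf S K ρ) ∪ Set.range (fun i => lab (xf i)))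
      (LayeredHom (L : E3 →L[ℝ] E3) w) (lab (xf i)) := fun i =>
    (isTameStarR_of_shadow_registered (y₀ := fun i => lab (xf i)) hRs (by linarith) hε₀ hdet hsh hyC i (hreg i)).mono
      le_rfl hϑ₀
  -- the patch sites are pairwise `≥ σ` apart (label injective on the zone, `xf` injective, `C` separated)
  have hy₀sep : ∀ i j, i ≠ j → σ ≤ dist (lab (xf i)) (lab (xf j)) := fun i j hij =>
    hsepC _ (hyC i) _ (hyC j) fun h => hij (hxf (hlab.2.2.1 ⟨hxS i, hxz i⟩ ⟨hxS j, hxz j⟩ h))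
  -- exterior atoms are `> dI` away from the patch sites: their own labels are other `C`-sites within `ε` of them
  have hfar : ∀ i, ∀ p ∈ S \ coreOf S K ρ, dist p (lab (xf i)) ≤ Rg → dI < dist p (lab (xf i)) := fun i p hp hd => by
    obtain ⟨hz, hc⟩ := hXnear i p hp hd
    have hcool : ∀ k ∈ K, rΘ < dist p k := fun k hk => by linarith [hc k hk]
    have hlabp : dist p (lab p) ≤ ε := hlab.2.2.2 p hp.1 hz hcool
    have hlpC : lab p ∈ placedCrystal L' w' U t := hlab.1 p hp.1 hz
    have hne : lab p ≠ lab (xf i) := fun h => by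
      have hpx : p = xf i := hlab.2.2.1 ⟨hp.1, hz⟩ ⟨hxS i, hxz i⟩ h
      exact hp.2 (hpx ▸ hcore i)
    have hsep := hsepC _ hlpC _ (hyC i) hne
    linarith [dist_triangle (lab p) p (lab (xf i)), dist_comm p (lab p)]
  refine ⟨fun i => (href i).isTameStar (by linarith), fun z hz => ?_⟩
  have hinj : Function.Injective z := injective_of_mem_bondTube_of_sep hy₀sep h2dB hz
  have hdisj : Disjoint (Set.range z) (S \ coreOf S K ρ) := disjoint_of_mem_bondTube_of_far hfar (by linarith) hz
  exact ⟨hinj, hdisj, fun i => isTameStar_tube_of_reference hdB₀ hRg le_rfl hϑ href hz hinj hdisj i⟩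

/-- ★★★ **(XRᴸ) AT THE RECORD DIALS** `(ϑp, r, rΘ, q, rsh, ρ, rm) = (1/10, 8, 145/16, 4, 12, 16, 16)`, `(σ, ϑr, Rs, ε, rI, ℓ) = (17/20, 10⁻⁴, 5,
10⁻⁴, 10, 43/2)`, `(aHi, Λ, θ, s) = (1, 2, 1/16, 1/50)`, for EVERY moat level `ϑc`, door level `ϑ`, and all tube dials with `0 ≤ dB < 17/40`,
`4 + 2dB ≤ Rg < 43/2 − 16 − 10⁻⁴`, `4 + 2dB + 10⁻⁴ ≤ 5`, `dI + 10⁻⁴ < 17/20`, `1/5000 ≤ ϑ₀`, `ϑ₀ + max sb dI ≤ ϑ`. [this file, g85] -/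
theorem labelTubeReferenceP_record (ϑc : ℝ) {ϑ ϑ₀ Rg sb dI dB : ℝ} (hdB₀ : 0 ≤ dB) (h2dB : 2 * dB < 17 / 20) (hRg : 4 + 2 * dB ≤ Rg)
    (hRs : 4 + 2 * dB + 1 / 10000 ≤ 5) (hfit : 16 + 1 / 10000 + Rg < 43 / 2) (hdI : dI + 1 / 10000 < 17 / 20)
    (hϑ₀ : (1 : ℝ) / 10000 + 1 / 10000 ≤ ϑ₀) (hϑ : ϑ₀ + max sb dI ≤ ϑ) :
    LabelTubeReferenceP ϑc ϑ (1 / 10) 8 (145 / 16) 4 12 16 16 (17 / 20) (1 / 10000) 5 (1 / 10000) 10 (43 / 2) ϑ₀ Rg sb dI dB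
      1 2 (1 / 16) (1 / 50) :=
  labelTubeReferenceP_of_dials (by norm_num) (by norm_num) (by norm_num) (by norm_num) (by norm_num) (by norm_num) (by norm_num)
    (by norm_num) hfit hdB₀ hRg hRs h2dB hdI hϑ₀ hϑ

/-- (XRᴸ) at the record dials AND the row-1237 tube marks `(ϑ₀, Rg, sb, dI, dB) = (1/400, 5, 3/400, 3/400, 3/10)`, door level `tameRadius`.
[this file, g85] -/
theorem labelTubeReferenceP_marks (ϑc : ℝ) :
    LabelTubeReferenceP ϑc tameRadius (1 / 10) 8 (145 / 16) 4 12 16 16 (17 / 20) (1 / 10000) 5 (1 / 10000) 10 (43 / 2) (1 / 400) 5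
      (3 / 400) (3 / 400) (3 / 10) 1 2 (1 / 16) (1 / 50) :=
  labelTubeReferenceP_record ϑc (by norm_num) (by norm_num) (by norm_num) (by norm_num) (by norm_num) (by norm_num) (by norm_num)
    (by rw [max_self]; norm_num [tameRadius])

end LabelTubeReference

/-! ### ZZZQ-3  The W2 door with four hypotheses -/

section W2Four

/-- ★★★ **THE W2 DOOR ⟸ (SC) ∧ (X1ᴸ) ∧ (X2ᴸ) ∧ (QCᴸ)** — tree ZZZP `mildCoolMoatCorePG_W2_record` with (XRᴸ) DISCHARGED by `labelTubeReferenceP_record`;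
tube dials free in the polytope of `labelTubeReferenceP_record` (door level `ϑ = tameRadius = 1/20`). [this file, g85] -/
theorem mildCoolMoatCorePG_W2_of_four {ϑc ϑ₀ Rg sb dI dB sb₁ dI₁ dB₁ lam κ : ℝ}
    (hlam : 0 < lam) (hκ : 0 < κ) (hsb : sb₁ < sb) (hdI : dI₁ < dI) (hdB : dB₁ < dB) (hsb₀ : 0 ≤ sb₁) (hdI₀ : 0 ≤ dI₁) (hdB₀ : 0 ≤ dB₁)
    (h2dB : 2 * dB < 17 / 20) (hRg : 4 + 2 * dB ≤ Rg) (hRs : 4 + 2 * dB + 1 / 10000 ≤ 5) (hfit : 16 + 1 / 10000 + Rg < 43 / 2)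
    (hdIσ : dI + 1 / 10000 < 17 / 20) (hϑ₀ : (1 : ℝ) / 10000 + 1 / 10000 ≤ ϑ₀) (hϑ : ϑ₀ + max sb dI ≤ tameRadius)
    (hSC : CoolZoneShadowCrystalP ϑc (1 / 10) 8 4 12 16 (17 / 20) (1 / 10000) 5 (1 / 10000) 10 (43 / 2) 1 2 (1 / 16) (1 / 50))
    (hX1 : LabelTubeConvexityP ϑc tameRadius (1 / 10) 8 (145 / 16) 4 12 16 16 (17 / 20) (1 / 10000) 5 (1 / 10000) 10 (43 / 2) ϑ₀ Rg sb dI dB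
      lam 1 2 (1 / 16) (1 / 50))
    (hX2 : LabelLoadedTubeAprioriP ϑc tameRadius (1 / 10) 8 (145 / 16) 4 12 16 16 (17 / 20) (1 / 10000) 5 (1 / 10000) 10 (43 / 2) ϑ₀ Rg sb dI
      dB sb₁ dI₁ dB₁ 1 2 (1 / 16) (1 / 50))
    (hQC : LabelSegmentCoercivityP ϑc tameRadius (1 / 10) 8 (145 / 16) 4 12 16 16 (17 / 20) (1 / 10000) 5 (1 / 10000) 10 (43 / 2) dB₁ κ 1 2
      (1 / 16) (1 / 50)) :
    MildCoolMoatCorePG ϑc tameRadius (1 / 10) 8 4 12 16 1 2 (1 / 16) (1 / 50) :=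
  mildCoolMoatCorePG_W2_record hlam hκ hsb hdI hdB hsb₀ hdI₀ hdB₀ hSC
    (labelTubeReferenceP_record ϑc (hdB₀.trans hdB.le) h2dB hRg hRs hfit hdIσ hϑ₀ hϑ) hX1 hX2 hQC

/-- ★★ **THE W2 DOOR AT THE ROW-1237 TUBE MARKS** `(ϑ₀, Rg, sb, dI, dB) = (1/400, 5, 3/400, 3/400, 3/10)`: `[MCMC](ϑc)` ⟸ (SC) ∧ (X1ᴸ)(lam > 0) ∧
(X2ᴸ)(0 ≤ sb₁ < 3/400, 0 ≤ dI₁ < 3/400, 0 ≤ dB₁ < 3/10) ∧ (QCᴸ)(dL := dB₁, κ > 0). [this file, g85] -/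
theorem mildCoolMoatCorePG_W2_marks {ϑc sb₁ dI₁ dB₁ lam κ : ℝ} (hlam : 0 < lam) (hκ : 0 < κ) (hsb : sb₁ < 3 / 400) (hdI : dI₁ < 3 / 400)
    (hdB : dB₁ < 3 / 10) (hsb₀ : 0 ≤ sb₁) (hdI₀ : 0 ≤ dI₁) (hdB₀ : 0 ≤ dB₁)
    (hSC : CoolZoneShadowCrystalP ϑc (1 / 10) 8 4 12 16 (17 / 20) (1 / 10000) 5 (1 / 10000) 10 (43 / 2) 1 2 (1 / 16) (1 / 50))
    (hX1 : LabelTubeConvexityP ϑc tameRadius (1 / 10) 8 (145 / 16) 4 12 16 16 (17 / 20) (1 / 10000) 5 (1 / 10000) 10 (43 / 2) (1 / 400) 5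
      (3 / 400) (3 / 400) (3 / 10) lam 1 2 (1 / 16) (1 / 50))
    (hX2 : LabelLoadedTubeAprioriP ϑc tameRadius (1 / 10) 8 (145 / 16) 4 12 16 16 (17 / 20) (1 / 10000) 5 (1 / 10000) 10 (43 / 2) (1 / 400) 5
      (3 / 400) (3 / 400) (3 / 10) sb₁ dI₁ dB₁ 1 2 (1 / 16) (1 / 50))
    (hQC : LabelSegmentCoercivityP ϑc tameRadius (1 / 10) 8 (145 / 16) 4 12 16 16 (17 / 20) (1 / 10000) 5 (1 / 10000) 10 (43 / 2) dB₁ κ 1 2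
      (1 / 16) (1 / 50)) :
    MildCoolMoatCorePG ϑc tameRadius (1 / 10) 8 4 12 16 1 2 (1 / 16) (1 / 50) :=
  mildCoolMoatCorePG_W2_record hlam hκ hsb hdI hdB hsb₀ hdI₀ hdB₀ hSC (labelTubeReferenceP_marks ϑc) hX1 hX2 hQC

end W2Four

end Summit.AtomisticToContinuum.Crystallization.Theorems.ChartedZeroExcessLayeredLatticeLiouville

end
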